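import Literature.Computability.AlgebraicComplexity.LMR13DualVarieties
import Literature.Computability.AlgebraicComplexity.OrbitCoordinateRingProofs
import Literature.Computability.AlgebraicComplexity.DeterminantIrreducible
import HarnessLib

/-!
# Orbit closures are closed and irreducible (coefficient-space Zariski topology) — PROVED

Fifth proofs sibling of `Literature/Computability/AlgebraicComplexity/LMR13DualVarieties.lean` (cell
`val-lit`, typer `val-lit-t11`). Honest framing: typed literature; VP ≠ VNP is NOT proved and nothing
here is progress on it.

The statement file types "the `PGL_{n²}`-orbit closure of `[det_n]` is an irreducible component of
`𝒟ual_{2n−2,n,n²}`" (Landsberg–Manivel–Ressayre 2013, Thm. 3.1.1, journal p. 476) as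
`IsCoeffIrreducibleComponent (orbitClosure det_n) (lmrDualScheme (2n−2) n)` =
`S ⊆ T ∧ IsCoeffZariskiIrreducible S ∧ (maximality among irreducible subsets of T)`, with Hartshorne's
definitions of closed / irreducible sets (I §1) transported to coefficient space
(`IsCoeffZariskiClosed`, `IsCoeffZariskiIrreducible`). This file PROVES the middle conjunct for every
nonzero form `f` over `ℂ`:

* `orbitClosure_isCoeffZariskiClosed` — `Δ[f] = \overline{GL·f}` is closed (idempotence of closure);
* `orbitClosure_isCoeffZariskiIrreducible` — `Δ[f]` is irreducible: if `Δ[f] ⊆ C₁ ∪ C₂` with `Cᵢ`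
  closed and `sᵢ ∈ Δ[f] ∖ Cᵢ`, separating polynomials `pᵢ` (vanishing on `Cᵢ`, not at `sᵢ`) restrict
  to the degree-`m` coordinates, their product vanishes on the orbit, so lies in the PRIME ideal
  `I(GL·f)` (tree `orbitVanishingIdeal_isPrime`, Bürgisser–Ikenmeyer–Panova 2019 Lemma 2.2:
  "irreducibility of the variety"), whence one `pᵢ` vanishes on all of `Δ[f]` (tree
  `mem_orbitClosure_iff_formCoeff_holds`) — contradiction;
* `isCoeffIrreducibleComponent_orbitClosure_iff` — hence, for `Δ[f] ⊆ T`, the component property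
  reduces to the maximality clause (what remains of Thm. 3.1.1's second assertion once
  `Δ[det_n] ⊆ 𝒟ual_{2n−2,n,n²}` is known).

## References

* [BurgisserIkenmeyerPanovaJAMS2019] J. AMS 32 (2019), Lemma 2.2 (irreducibility of orbit closures).
* [Hartshorne1977] *Algebraic Geometry*, I §1 (pp. 2–5): closed sets, irreducible sets, components.
* [LandsbergManivelRessayre2013] Comment. Math. Helv. 88 (2013), Thm. 3.1.1 (p. 476).
-/

noncomputable section

open MvPolynomial

namespace Literature.Computability.AlgebraicComplexity

open _root_.Literature.NumberTheory.DiophantineGeometry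

variable {σ : Type*} [Fintype σ] [DecidableEq σ]

omit [Fintype σ] [DecidableEq σ] in
/-- A point outside a closed set of forms is separated from it by a polynomial in the coefficients
(Hartshorne I §1: the closed sets are the common zero sets). [cite: Hartshorne1977, I §1 (p. 2)] -/
theorem exists_aeval_ne_zero_of_not_mem {C : Set (MvPolynomial σ ℂ)} (hC : IsCoeffZariskiClosed C)
    {s : MvPolynomial σ ℂ} (hs : s ∉ C) :
    ∃ p : MvPolynomial (σ →₀ ℕ) ℂ, (∀ c ∈ C, aeval (coeffVec c) p = 0) ∧ aeval (coeffVec s) p ≠ 0 := by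
  by_contra h
  push Not at h
  exact hs (hC s (mem_zariskiClosure_iff.mpr fun p hp => h p fun c hc => hp _ ⟨c, hc, rfl⟩))

/-- **Orbit closures are closed**: `Δ[f] = \overline{GL·f}` is Zariski closed in coefficient space
(idempotence of the closure; Hartshorne I §1). [cite: Hartshorne1977, I §1 (p. 2)] -/
theorem orbitClosure_isCoeffZariskiClosed (f : MvPolynomial σ ℂ) :
    IsCoeffZariskiClosed (orbitClosure f) := by
  intro g hg
  have hsub : coeffVec '' orbitClosure f ⊆ zariskiClosure (coeffVec '' glOrbit σ ℂ f) := by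
    rintro _ ⟨h, hh, rfl⟩
    exact hh
  have := zariskiClosure_mono hsub hg
  rwa [zariskiClosure_zariskiClosure] at this

/-- Restricting a test polynomial to the degree-`m` coordinates does not change its values on forms
of degree `m` (the other coordinates vanish there; Mulmuley–Sohoni's `V = Sym^m`).
[cite: MulmuleySohoni2001, §4] -/
theorem aeval_formCoeff_aeval_restrict {m : ℕ} {h : MvPolynomial σ ℂ} (hh : h.IsHomogeneous m)
    (p : MvPolynomial (σ →₀ ℕ) ℂ) :
    aeval (formCoeff m h)
        (aeval (fun μ : σ →₀ ℕ =>
          if hμ : μ ∈ degMonomials σ m then (X ⟨μ, hμ⟩ : MvPolynomial (DegIdx σ m) ℂ) else 0) p) =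
      aeval (coeffVec h) p := by
  rw [comp_aeval_apply]
  have hfun : (fun μ : σ →₀ ℕ => aeval (formCoeff m h)
      (if hμ : μ ∈ degMonomials σ m then (X ⟨μ, hμ⟩ : MvPolynomial (DegIdx σ m) ℂ) else 0)) =
      coeffVec h := by
    funext μ
    by_cases hμ : μ ∈ degMonomials σ m
    · rw [dif_pos hμ, aeval_X, formCoeff_apply, coeffVec_apply]
    · rw [dif_neg hμ, map_zero, coeffVec_apply]
      exact (hh.coeff_eq_zero (fun hd => hμ (mem_degMonomials_iff.mpr hd))).symm
  rw [hfun]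

/-- **Orbit closures are irreducible** (coefficient-space Zariski topology, Hartshorne's definition
I §1 p. 3): for a nonzero form `f` of degree `m` over `ℂ`, `Δ[f]` is nonempty and whenever
`Δ[f] ⊆ C₁ ∪ C₂` with `C₁, C₂` closed, `Δ[f] ⊆ C₁` or `Δ[f] ⊆ C₂`. From the primality of the
vanishing ideal `I(GL·f) ⊆ ℂ[Sym^m]` (tree `orbitVanishingIdeal_isPrime`; Bürgisser–Ikenmeyer–Panova
2019, proof of Lemma 2.2, "irreducibility of the variety": `GL` is irreducible) and the description of
`Δ[f]` as the zero set of that ideal (tree `mem_orbitClosure_iff_formCoeff_holds`).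
[cite: BurgisserIkenmeyerPanovaJAMS2019, Lemma 2.2] -/
theorem orbitClosure_isCoeffZariskiIrreducible {f : MvPolynomial σ ℂ} {m : ℕ}
    (hf : f.IsHomogeneous m) (hf0 : f ≠ 0) : IsCoeffZariskiIrreducible (orbitClosure f) := by
  classical
  refine ⟨⟨f, mem_orbitClosure_self f⟩, fun C₁ C₂ hC₁ hC₂ hcover => ?_⟩
  by_contra hnot
  obtain ⟨h1, h2⟩ := not_or.mp hnot
  obtain ⟨s₁, hs₁S, hs₁C⟩ := Set.not_subset.mp h1
  obtain ⟨s₂, hs₂S, hs₂C⟩ := Set.not_subset.mp h2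
  obtain ⟨p₁, hp₁C, hp₁s⟩ := exists_aeval_ne_zero_of_not_mem hC₁ hs₁C
  obtain ⟨p₂, hp₂C, hp₂s⟩ := exists_aeval_ne_zero_of_not_mem hC₂ hs₂C
  -- restrict the separating polynomials to the degree-`m` coordinates
  set θ : (σ →₀ ℕ) → MvPolynomial (DegIdx σ m) ℂ := fun μ =>
    if hμ : μ ∈ degMonomials σ m then (X ⟨μ, hμ⟩ : MvPolynomial (DegIdx σ m) ℂ) else 0 with hθ
  have hθeval : ∀ h : MvPolynomial σ ℂ, h.IsHomogeneous m → ∀ p : MvPolynomial (σ →₀ ℕ) ℂ,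
      aeval (formCoeff m h) (aeval θ p) = aeval (coeffVec h) p := fun h hh p =>
    aeval_formCoeff_aeval_restrict hh p
  have hmem : aeval θ p₁ * aeval θ p₂ ∈ orbitVanishingIdeal f m := by
    rw [mem_orbitVanishingIdeal_iff]
    intro g
    have hgS : linSubstRep σ ℂ g f ∈ orbitClosure f := glOrbit_subset_orbitClosure f ⟨g, rfl⟩
    have hghom : (linSubstRep σ ℂ g f).IsHomogeneous m := by
      rw [linSubstRep_apply]
      exact linSubst_isHomogeneous _ hf
    rw [map_mul, hθeval _ hghom, hθeval _ hghom]
    rcases hcover hgS with hc | hc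
    · rw [hp₁C _ hc, zero_mul]
    · rw [hp₂C _ hc, mul_zero]
  rcases (orbitVanishingIdeal_isPrime f m).mem_or_mem hmem with hq | hq
  · apply hp₁s
    obtain ⟨-, hZ⟩ := (mem_orbitClosure_iff_formCoeff_holds hf hf0).mp hs₁S
    rw [← hθeval s₁ (hf.of_mem_orbitClosure hs₁S)]
    exact hZ _ hq
  · apply hp₂s
    obtain ⟨-, hZ⟩ := (mem_orbitClosure_iff_formCoeff_holds hf hf0).mp hs₂S
    rw [← hθeval s₂ (hf.of_mem_orbitClosure hs₂S)]
    exact hZ _ hq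

omit [Fintype σ] [DecidableEq σ] in
/-- For an irreducible `S ⊆ T`, being an irreducible component of `T` is exactly the maximality
clause (Hartshorne I §1, Cor. 1.6). [cite: Hartshorne1977, I §1 Cor. 1.6 (p. 5)] -/
theorem isCoeffIrreducibleComponent_iff_of_irreducible {S T : Set (MvPolynomial σ ℂ)}
    (hST : S ⊆ T) (hS : IsCoeffZariskiIrreducible S) :
    IsCoeffIrreducibleComponent S T ↔
      ∀ S' : Set (MvPolynomial σ ℂ), IsCoeffZariskiIrreducible S' → S ⊆ S' → S' ⊆ T → S' ⊆ S :=
  ⟨fun h => h.2.2, fun h => ⟨hST, hS, h⟩⟩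

/-- **The orbit closure of the determinant is closed and irreducible** (`n ≥ 1`): the middle
conjunct of the component clause of LMR 2013, Thm. 3.1.1 as typed (`LMR2013_thm_3_1_1`,
`IsCoeffIrreducibleComponent (orbitClosure det_n) (lmrDualScheme (2n−2) n)`); with
`Δ[det_n] ⊆ 𝒟ual_{2n−2,n,n²}` (sibling file `LMR13DualSchemeDetProofs.lean`) only the MAXIMALITY of
`Δ[det_n]` among the irreducible subsets of `𝒟ual` — the printed content of "is an irreducible
component" — remains in the named fact. [cite: LandsbergManivelRessayre2013, Theorem 3.1.1 (p. 476)] -/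
theorem orbitClosure_detPoly_isCoeffZariskiIrreducible {n : ℕ} (hn : 1 ≤ n) :
    IsCoeffZariskiIrreducible (orbitClosure (detPoly (Fin n) ℂ)) := by
  haveI : Nonempty (Fin n) := ⟨⟨0, hn⟩⟩
  have hdet : (detPoly (Fin n) ℂ).IsHomogeneous (Fintype.card (Fin n)) := detPoly_isHomogeneous
  exact orbitClosure_isCoeffZariskiIrreducible hdet (detPoly_prime (n := Fin n) (k := ℂ)).ne_zero

end Literature.Computability.AlgebraicComplexity
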